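import Literature.NumberTheory.GaloisRepresentations.LocalFieldFiniteExtension
import Literature.NumberTheory.GaloisRepresentations.GaloisSubgroups
import Literature.NumberTheory.GaloisRepresentations.LocalField
import HarnessLib

/-!
# Local-field glue for the tame layer: the extended valuation on a finite `E/K`
# (cell `b2b-bsdres`, team n1011, row T-EPC = Tate's local Euler–Poincaré characteristic; seat p04 GEN 8; stage C4b)

HONEST FRAMING (cell `b2b-bsdres`, run/shared/lean/b2b/bsd-rank1-residual/, verbatim in every
file): the goal of the cell is to DELETE the COMBINATION-SHAPED residual classes of the
Birch–Swinnerton-Dyer formula for ALL analytic-rank `≤ 1` elliptic curves over `ℚ` — "full BSD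
formula for every rank `≤ 1` curve in class `C`" assembled STRICTLY from published theorems — so
that the rank-`≤ 1` remainder becomes exactly the CONSTRUCTION-SHAPED classes, which are TYPED
(missing-input `Prop`s), NOT attempted. This is not "finishing BSD". Team n1011 (N10 / N11, the
additive block X4 ∧ `p = 3`): research route; no claim beyond the stated classes; nothing is
booked; no mark / label is changed by this file. Theorems only (no definition, no named fact, no
`sorry`); TOOL theorems on local fields.  (Placement: Summits/GaloisImage with the T-EPC cone.)

## What

Stage B7 (Milne's Lemma 2.11) is stated for an abstract finite Galois `E/K` with `E` a
non-archimedean local field whose valuation is `Gal(E/K)`-invariant, `|p| < 1`, and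
`𝒪_K = K ∩ 𝒪_E`.  For a finite extension `L` of the local field `K` equipped with the tree's
structures `FiniteExtension.valuativeRel/topologicalSpace K L` (the spectral norm; Serre,
*Local Fields* II §2 Prop. 3, Cor. 2) this file checks those hypotheses:

* `EPCLocalField.valuation_algEquiv` — `K`-automorphisms preserve the extended valuation
  (uniqueness of the prolongation; Mathlib `spectralNorm_eq_of_equiv`);
* `EPCLocalField.algebraMap_mem_integer_iff` — `algebraMap K L a ∈ 𝒪_L ↔ a ∈ 𝒪_K`;
* `EPCLocalField.valuation_natCast_lt_one_iff` — `|n|_L < 1 ↔ |n|_K < 1`;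
* `EPCLocalField.exists_submodule_integer` — `𝒪_K` as a membership-characterised `ℤ`-submodule;
* `EPCLocalField.index_galFixing`, `natCard_algEquiv_eq_index` — for `E ⊆ k̄` normal over `k`,
  `#Gal(E/k) = (Γ_k : Gal(k̄/E))`, and `Γ_k / Gal(k̄/E)` is finite.

References: J.-P. Serre, *Local Fields* (1979), II §2 Prop. 3 and Cor. 2 [SerreLocalFields1979];
J. S. Milne, *Arithmetic Duality Theorems* (2006), I §2 [MilneADT2006].
-/

noncomputable section

open Function Field
open scoped ValuativeRel
open Literature.NumberTheory.GaloisRepresentations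
open Literature.NumberTheory.GaloisRepresentations.LocalWeilDatum (galFixing mem_galFixing_iff)

universe u

namespace Summit.BirchSwinnertonDyer.Rank1Residual.GaloisImage

namespace EPCLocalField

section Valuation

variable (K : Type*) [Field K] [ValuativeRel K] [TopologicalSpace K] [IsNonarchimedeanLocalField K]
  (L : Type*) [Field L] [Algebra K L] [FiniteDimensional K L]

/-- **`K`-automorphisms preserve the extended valuation** of a finite extension `L/K` of a
non-archimedean local field (uniqueness of the prolongation: the valuation is given by the spectral
norm, which is `Gal(L/K)`-invariant, Mathlib `spectralNorm_eq_of_equiv`).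
[cite: SerreLocalFields1979, Ch. II §2 Cor. 2] -/
theorem valuation_algEquiv (σ : L ≃ₐ[K] L) (x : L) :
    letI := FiniteExtension.valuativeRel K L
    ValuativeRel.valuation L (σ x) = ValuativeRel.valuation L x := by
  letI := FiniteExtension.valuativeRel K L
  have hnorm : @Norm.norm L (FiniteExtension.normedField K L).toNorm (σ x) =
      @Norm.norm L (FiniteExtension.normedField K L).toNorm x := by
    rw [FiniteExtension.norm_def, FiniteExtension.norm_def]
    letI := IsNonarchimedeanLocalField.nontriviallyNormedField K
    exact (spectralNorm_eq_of_equiv σ x).symm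
  refine le_antisymm ?_ ?_
  · rw [← (ValuativeRel.valuation L).vle_iff_le, FiniteExtension.vle_iff_norm_le, hnorm]
  · rw [← (ValuativeRel.valuation L).vle_iff_le, FiniteExtension.vle_iff_norm_le, hnorm]

/-- **`algebraMap K L a ∈ 𝒪_L ↔ a ∈ 𝒪_K`**: the extended valuation prolongs that of `K`.
[cite: SerreLocalFields1979, Ch. II §2 Cor. 2] -/
theorem algebraMap_mem_integer_iff (a : K) :
    letI := FiniteExtension.valuativeRel K L
    algebraMap K L a ∈ 𝒪[L] ↔ a ∈ 𝒪[K] := by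
  letI := FiniteExtension.valuativeRel K L
  haveI := FiniteExtension.valuativeExtension K L
  rw [Valuation.mem_integer_iff, Valuation.mem_integer_iff, ← (ValuativeRel.valuation L).vle_one_iff,
    ← (ValuativeRel.valuation K).vle_one_iff, ← map_one (algebraMap K L),
    ValuativeExtension.vle_iff_vle]

/-- **`|n|_L < 1 ↔ |n|_K < 1`** for a natural number `n`. [cite: SerreLocalFields1979, Ch. II §2 Cor. 2] -/
theorem valuation_natCast_lt_one_iff (n : ℕ) :
    letI := FiniteExtension.valuativeRel K L
    ValuativeRel.valuation L n < 1 ↔ ValuativeRel.valuation K n < 1 := by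
  letI := FiniteExtension.valuativeRel K L
  haveI := FiniteExtension.valuativeExtension K L
  rw [lt_iff_not_ge, lt_iff_not_ge, ← (ValuativeRel.valuation L).one_vle_iff,
    ← (ValuativeRel.valuation K).one_vle_iff, ← map_natCast (algebraMap K L), ← map_one (algebraMap K L),
    ValuativeExtension.vle_iff_vle]

/-- **`𝒪_K = K ∩ 𝒪_L` as a membership-characterised `ℤ`-submodule of `K`** (the `OK` of stage B7).
[folklore] -/
theorem exists_submodule_integer :
    letI := FiniteExtension.valuativeRel K L
    ∃ OK : Submodule ℤ K, (∀ a : K, a ∈ OK ↔ algebraMap K L a ∈ 𝒪[L]) ∧ ∀ a : K, a ∈ OK ↔ a ∈ 𝒪[K] := by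
  letI := FiniteExtension.valuativeRel K L
  refine ⟨AddSubgroup.toIntSubmodule (𝒪[K]).toAddSubgroup, fun a => ?_, fun a => Iff.rfl⟩
  rw [algebraMap_mem_integer_iff]
  rfl

end Valuation

/-! ### The finite layer `Gal(E/k) = Γ_k / Gal(k̄/E)` -/

section Index

variable (k : Type u) [Field k] (E : IntermediateField k (AlgebraicClosure k)) [Normal k E]

/-- `(Γ_k : Gal(k̄/E)) = #Gal(E/k)` for a normal subextension `E ⊆ k̄`. [folklore] -/
theorem index_galFixing : (galFixing k E).index = Nat.card (↥E ≃ₐ[k] ↥E) := by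
  rw [← ker_resGal E, Subgroup.index_ker, MonoidHom.range_eq_top.2 (resGal_surjective E),
    Subgroup.card_top]

/-- `Γ_k / Gal(k̄/E)` is finite for `E/k` finite normal. [folklore] -/
theorem finite_quotient_galFixing [FiniteDimensional k E] :
    Finite (absoluteGaloisGroup k ⧸ galFixing k E) := by
  haveI : (galFixing k E).FiniteIndex := by
    refine ⟨?_⟩
    rw [index_galFixing]
    exact Nat.card_pos.ne'
  exact Subgroup.finite_quotient_of_finiteIndex

end Index

end EPCLocalField

end Summit.BirchSwinnertonDyer.Rank1Residual.GaloisImage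

end
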